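import Summits.QuantumFields.YangMills.Theorems.BalabanUVNodesN15CovariantAveragingObjects
import Literature.MathematicalPhysics.QuantumFieldTheory.Balaban1983to89.T4AxialChain
import HarnessLib

/-!
# Route «BalabanUVNodes», node N15 = NE2, road (c) — PROGRAMME (P-Q), IIa: THE SIZES OF THE TRANSPORTS OF (125) — max-row-sum and max-column-sum of `T(Γ) − 1` along the
# staircase+line contours are `≤ (1+ρ)^{(d+2)n} − 1` once every one-bond transporter is `ρ`-close to `1` (instance-free ordered-product algebra)

Cell `pub-ymgap`, seat `pub-ymgap-dag-n15-c` (generation g21; R134 (a) seat, strategy s1; HUMAN RULING D-0062; chair R424 venue).  `bears_on: R4∕N15 · K3⁸ SpineGivenEndpointR13SepCoPHV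
(stmt-QuantumFields-27366)`; filed `--supports stmt-QuantumFields-27366 --as helper` — COUNT-NEUTRAL.  THEOREMS only ([folklore] matrix bookkeeping), 0 `def`, 0 `sorry`.  Imports BY NAME,
nothing in the tree modified ∕ restated: this seat's n15-c∕181 `…N15CovariantAveragingObjects` (`mprod`, `mprod_succ`, `transpose_mprod`, `cvaLeg`∕`cvaStair`∕`cvaLine`∕`cvaPath`, `blockCoords`) and the Literature's `T4AxialChain` (`pow_sub_one_mono`).

WHY.  The letters of the covariant averaging pair `Q(U)`, `Q*(U)` (sequel `…N15CovariantAveragingLetters`) reduce to the sizes of the transports `T(Γ) − 1` along the contours of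
[Balaban1985Averaging] (125): at most `(d+1)(n−1) + (n−1) < (d+2)n` one-bond factors, each `ρ`-close to `1`, so `T(Γ) − 1` is `≤ (1+ρ)^{(d+2)n} − 1` in max-row-sum AND (for the
adjoint, which transposes the colour kernel) max-column-sum — p. 36: «it has an estimate |(Q₀A)_c| ≤ |A|» (the transports are isometries up to the small field: shape).  Everything is
stated in the instance-free currency `Σ_j |A_{ij}| ≤ r` ∕ `Σ_i |A_{ij}| ≤ r` of the lineage's `hasMaj_mmulOp` letters (no matrix-norm instance is opened).

RESULTS ([folklore]).
* §1 `rows_mul_le`, `rows_one`, `rows_mul_sub_one_le` (`P·F − 1` from `P − 1`, `F − 1`), ★ `rows_mprod_sub_one_le` (`≤ (1+ρ)^N − 1`), `cols_eq_rows_transpose`, ★ `cols_mprod_sub_one_le`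
  (through `transpose_mprod`), `rows_le_of_rows_sub_one`∕`cols_le_of_cols_sub_one` (the monotonicity `(1+ρ)^m − 1 ≤ (1+ρ)^n − 1` is the Literature's `T4AxialChain.pow_sub_one_mono`, imported, not restated).
* §2 `rows_cvaStair_sub_one_le`∕`cols_cvaStair_sub_one_le` (`≤ (1+ρ)^{(d+1)n} − 1`), ★ **`rows_cvaPath_sub_one_le`** ∕ ★ **`cols_cvaPath_sub_one_le`** (`≤ (1+ρ)^{(d+2)n} − 1` for `s ≤ n`),
  `rows_cvaPath_le`∕`cols_cvaPath_le` (`≤ (1+ρ)^{(d+2)n}`).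

HONEST FRAMING ∕ LIMITS.  Elementary matrix algebra for the MODEL transports of n15-c∕181 (main term (125), one-level staircase, abstract transporter matrices); the smallness `ρ` is a
HYPOTHESIS (the cover sequel derives it from the small-field class); no estimate of Bałaban's.  NE2⁺ NOT PRINTED; N15 of record untouched (DISCHARGED AS CONSUMED); counts UNMOVED (typed
28∕28); one finite 𝕋⁴ at fixed ε per index — NOT infinite volume ∕ OS ∕ mass gap ∕ Clay.  Restate-immune (no Theses import).
-/

noncomputable section

open scoped BigOperators Matrix
open Finset

namespace Summit.QuantumFields.YangMills.BalabanUVNodes.N15.CovAvg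

open Literature.MathematicalPhysics.QuantumFieldTheory.Balaban1983to89
open Literature.MathematicalPhysics.QuantumFieldTheory.Balaban1983to89.B5Prop11Plancherel (Tor fine unitVec)
open Summit.QuantumFields.YangMills.BalabanUVNodes.N15.VectorPiece (bondAt blockCoords)

variable {d : ℕ}

/-! ## §1 Max-row-sum algebra of ordered products (instance-free) -/

section Rows

variable {ι : Type} [Fintype ι] [DecidableEq ι]

omit [DecidableEq ι] in
/-- Rows of a product: `Σ_j |(AB)_{ij}| ≤ (Σ_k |A_{ik}|)·b` when every row of `B` is `≤ b`. [folklore] -/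
theorem rows_mul_le (A B : Matrix ι ι ℝ) {b : ℝ} (hb : ∀ k, ∑ j, |B k j| ≤ b) (i : ι) :
    ∑ j, |(A * B) i j| ≤ (∑ k, |A i k|) * b := by
  calc ∑ j, |(A * B) i j| = ∑ j, |∑ k, A i k * B k j| := by simp only [Matrix.mul_apply]
    _ ≤ ∑ j, ∑ k, |A i k| * |B k j| := sum_le_sum fun j _ => (abs_sum_le_sum_abs _ _).trans (le_of_eq (sum_congr rfl fun k _ => abs_mul _ _))
    _ = ∑ k, |A i k| * ∑ j, |B k j| := by rw [sum_comm]; exact sum_congr rfl fun k _ => by rw [mul_sum]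
    _ ≤ ∑ k, |A i k| * b := sum_le_sum fun k _ => mul_le_mul_of_nonneg_left (hb k) (abs_nonneg _)
    _ = (∑ k, |A i k|) * b := by rw [sum_mul]

/-- Rows of the identity: `Σ_j |1_{ij}| = 1`. [folklore] -/
theorem rows_one (i : ι) : ∑ j, |(1 : Matrix ι ι ℝ) i j| = 1 := by
  simp [Matrix.one_apply, apply_ite]

/-- `P·F − 1 = (P − 1)(F − 1) + (P − 1) + (F − 1)`: rows of `P·F − 1` are `≤ (1 + x)(1 + ρ) − 1` when rows of `P − 1` are `≤ x` and rows of `F − 1` are `≤ ρ` (`ρ ≥ 0`). [folklore] -/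
theorem rows_mul_sub_one_le {P F : Matrix ι ι ℝ} {x ρ : ℝ} (hρ : 0 ≤ ρ) (hP : ∀ i, ∑ j, |(P - 1) i j| ≤ x) (hF : ∀ i, ∑ j, |(F - 1) i j| ≤ ρ) (i : ι) :
    ∑ j, |(P * F - 1) i j| ≤ (1 + x) * (1 + ρ) - 1 := by
  have hsplit : P * F - 1 = (P - 1) * (F - 1) + (P - 1) + (F - 1) := by noncomm_ring
  rw [hsplit]
  calc ∑ j, |((P - 1) * (F - 1) + (P - 1) + (F - 1)) i j|
      ≤ ∑ j, (|((P - 1) * (F - 1)) i j| + |(P - 1) i j| + |(F - 1) i j|) := sum_le_sum fun j _ => by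
        simp only [Matrix.add_apply]
        exact (abs_add_le _ _).trans (add_le_add (abs_add_le _ _) le_rfl)
    _ = ∑ j, |((P - 1) * (F - 1)) i j| + ∑ j, |(P - 1) i j| + ∑ j, |(F - 1) i j| := by rw [sum_add_distrib, sum_add_distrib]
    _ ≤ x * ρ + x + ρ := by
        have h1 := rows_mul_le (P - 1) (F - 1) hF i
        have h2 : (∑ k, |(P - 1) i k|) * ρ ≤ x * ρ := mul_le_mul_of_nonneg_right (hP i) hρ
        linarith [hP i, hF i]
    _ = (1 + x) * (1 + ρ) - 1 := by ring

/-- ★ ROWS OF AN ORDERED PRODUCT MINUS ONE: factors with rows of `F_t − 1` bounded by `ρ ≥ 0` give `Σ_j |(Π_{t<N} F_t − 1)_{ij}| ≤ (1+ρ)^N − 1`. [folklore] -/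
theorem rows_mprod_sub_one_le {F : ℕ → Matrix ι ι ℝ} {ρ : ℝ} (hρ : 0 ≤ ρ) {N : ℕ} (hF : ∀ t < N, ∀ i, ∑ j, |(F t - 1) i j| ≤ ρ) (i : ι) :
    ∑ j, |(mprod F N - 1) i j| ≤ (1 + ρ) ^ N - 1 := by
  induction N generalizing i with
  | zero => simp
  | succ N ih =>
      rw [mprod_succ]
      have hP : ∀ i, ∑ j, |(mprod F N - 1) i j| ≤ (1 + ρ) ^ N - 1 := fun i => ih (fun t ht => hF t (Nat.lt_succ_of_lt ht)) i
      refine (rows_mul_sub_one_le hρ hP (hF N (Nat.lt_succ_self N)) i).trans (le_of_eq ?_)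
      rw [pow_succ]; ring

omit [DecidableEq ι] in
/-- Columns are rows of the transpose. [folklore] -/
theorem cols_eq_rows_transpose (A : Matrix ι ι ℝ) (j : ι) : ∑ i, |A i j| = ∑ i, |Aᵀ j i| := rfl

/-- COLUMNS OF AN ORDERED PRODUCT MINUS ONE (the transposed product is the reversed product of transposes). [folklore] -/
theorem cols_mprod_sub_one_le {F : ℕ → Matrix ι ι ℝ} {ρ : ℝ} (hρ : 0 ≤ ρ) {N : ℕ} (hF : ∀ t < N, ∀ j, ∑ i, |(F t - 1) i j| ≤ ρ) (j : ι) :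
    ∑ i, |(mprod F N - 1) i j| ≤ (1 + ρ) ^ N - 1 := by
  rw [cols_eq_rows_transpose, Matrix.transpose_sub, Matrix.transpose_one, transpose_mprod]
  refine rows_mprod_sub_one_le hρ (fun t ht j' => ?_) j
  have h := hF (N - 1 - t) (by omega) j'
  simpa only [cols_eq_rows_transpose, Matrix.transpose_sub, Matrix.transpose_one] using h

/-- From `A − 1` to `A`: rows of `A` are `≤ 1 + x`. [folklore] -/
theorem rows_le_of_rows_sub_one {A : Matrix ι ι ℝ} {x : ℝ} (h : ∀ i, ∑ j, |(A - 1) i j| ≤ x) (i : ι) : ∑ j, |A i j| ≤ 1 + x := by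
  have hA : A = (A - 1) + 1 := by abel
  calc ∑ j, |A i j| = ∑ j, |((A - 1) + 1) i j| := by rw [← hA]
    _ ≤ ∑ j, (|(A - 1) i j| + |(1 : Matrix ι ι ℝ) i j|) := sum_le_sum fun j _ => by rw [Matrix.add_apply]; exact abs_add_le _ _
    _ = ∑ j, |(A - 1) i j| + 1 := by rw [sum_add_distrib, rows_one]
    _ ≤ 1 + x := by linarith [h i]

/-- From `A − 1` to `A`, columns. [folklore] -/
theorem cols_le_of_cols_sub_one {A : Matrix ι ι ℝ} {x : ℝ} (h : ∀ j, ∑ i, |(A - 1) i j| ≤ x) (j : ι) : ∑ i, |A i j| ≤ 1 + x := by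
  rw [cols_eq_rows_transpose]
  refine rows_le_of_rows_sub_one (A := Aᵀ) (fun j' => ?_) j
  simpa only [cols_eq_rows_transpose, Matrix.transpose_sub, Matrix.transpose_one] using h j'

end Rows

/-! ## §2 The transports of (125): at most `(d+2)n` factors -/

section Path

variable (M : Fin (d + 1) → ℕ) [∀ μ, NeZero (M μ)] (n : ℕ) [NeZero n] {ι : Type} [Fintype ι] [DecidableEq ι]

omit [∀ μ, NeZero (M μ)] in
/-- Rows of `cvaStair − 1`: `≤ (1+ρ)^{(d+1)n} − 1`. [folklore] -/
theorem rows_cvaStair_sub_one_le {T : Fin (d + 1) → Tor (fine n M) × Fin (d + 1) → Matrix ι ι ℝ} {ρ : ℝ} (hρ : 0 ≤ ρ)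
    (hT : ∀ μ p i, ∑ j, |(T μ p - 1) i j| ≤ ρ) (y : Tor M) (a : Fin (d + 1) → Fin n) (ν : Fin (d + 1)) (i : ι) :
    ∑ j, |(cvaStair M n T y a ν - 1) i j| ≤ (1 + ρ) ^ ((d + 1) * n) - 1 := by
  have hρ₁ : 0 ≤ (1 + ρ) ^ n - 1 := by have := one_le_pow₀ (M₀ := ℝ) (a := 1 + ρ) (by linarith) (n := n); linarith
  have hleg : ∀ t < d + 1, ∀ i, ∑ j, |((if h : t < d + 1 then cvaLeg M n T y a ⟨t, h⟩ ν else 1) - 1) i j| ≤ (1 + ρ) ^ n - 1 := by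
    intro t ht i
    rw [dif_pos ht, cvaLeg]
    exact (rows_mprod_sub_one_le hρ (fun s _ i' => hT _ _ i') i).trans (T4AxialChain.pow_sub_one_mono hρ (a ⟨t, ht⟩).isLt.le)
  refine (rows_mprod_sub_one_le hρ₁ hleg i).trans (le_of_eq ?_)
  rw [add_sub_cancel, ← pow_mul, mul_comm]

omit [∀ μ, NeZero (M μ)] in
/-- Columns of `cvaStair − 1`. [folklore] -/
theorem cols_cvaStair_sub_one_le {T : Fin (d + 1) → Tor (fine n M) × Fin (d + 1) → Matrix ι ι ℝ} {ρ : ℝ} (hρ : 0 ≤ ρ)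
    (hT : ∀ μ p j, ∑ i, |(T μ p - 1) i j| ≤ ρ) (y : Tor M) (a : Fin (d + 1) → Fin n) (ν : Fin (d + 1)) (j : ι) :
    ∑ i, |(cvaStair M n T y a ν - 1) i j| ≤ (1 + ρ) ^ ((d + 1) * n) - 1 := by
  have hρ₁ : 0 ≤ (1 + ρ) ^ n - 1 := by have := one_le_pow₀ (M₀ := ℝ) (a := 1 + ρ) (by linarith) (n := n); linarith
  have hleg : ∀ t < d + 1, ∀ j, ∑ i, |((if h : t < d + 1 then cvaLeg M n T y a ⟨t, h⟩ ν else 1) - 1) i j| ≤ (1 + ρ) ^ n - 1 := by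
    intro t ht j
    rw [dif_pos ht, cvaLeg]
    exact (cols_mprod_sub_one_le hρ (fun s _ j' => hT _ _ j') j).trans (T4AxialChain.pow_sub_one_mono hρ (a ⟨t, ht⟩).isLt.le)
  refine (cols_mprod_sub_one_le hρ₁ hleg j).trans (le_of_eq ?_)
  rw [add_sub_cancel, ← pow_mul, mul_comm]

/-- ★ ROWS OF THE TRANSPORT OF (125) MINUS ONE: `Σ_j |(cvaPath T p s − 1)_{ij}| ≤ (1+ρ)^{(d+2)n} − 1` for `s ≤ n`, transporters `ρ`-close to `1` in rows.
[cite: Balaban1985Averaging, (125)–(126) p.36 («|(Q₀A)_c| ≤ |A|»: the transports are isometries up to the small field — shape)] -/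
theorem rows_cvaPath_sub_one_le {T : Fin (d + 1) → Tor (fine n M) × Fin (d + 1) → Matrix ι ι ℝ} {ρ : ℝ} (hρ : 0 ≤ ρ)
    (hT : ∀ μ p i, ∑ j, |(T μ p - 1) i j| ≤ ρ) (p : Tor (fine n M) × Fin (d + 1)) {s : ℕ} (hs : s ≤ n) (i : ι) :
    ∑ j, |(cvaPath M n T p s - 1) i j| ≤ (1 + ρ) ^ ((d + 2) * n) - 1 := by
  have hline : ∀ i, ∑ j, |(cvaLine M n T p s - 1) i j| ≤ (1 + ρ) ^ n - 1 := fun i =>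
    (rows_mprod_sub_one_le hρ (fun t _ i' => hT _ _ i') i).trans (T4AxialChain.pow_sub_one_mono hρ hs)
  have hρ₁ : 0 ≤ (1 + ρ) ^ n - 1 := by have := one_le_pow₀ (M₀ := ℝ) (a := 1 + ρ) (by linarith) (n := n); linarith
  refine (rows_mul_sub_one_le hρ₁ (rows_cvaStair_sub_one_le M n hρ hT _ _ _) hline i).trans (le_of_eq ?_)
  rw [add_sub_cancel, add_sub_cancel, ← pow_add]; ring_nf

/-- ★ COLUMNS OF THE TRANSPORT OF (125) MINUS ONE (transporters `ρ`-close to `1` in columns). [cite: Balaban1985Averaging, (125)–(126) p.36 (shape)] -/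
theorem cols_cvaPath_sub_one_le {T : Fin (d + 1) → Tor (fine n M) × Fin (d + 1) → Matrix ι ι ℝ} {ρ : ℝ} (hρ : 0 ≤ ρ)
    (hT : ∀ μ p j, ∑ i, |(T μ p - 1) i j| ≤ ρ) (p : Tor (fine n M) × Fin (d + 1)) {s : ℕ} (hs : s ≤ n) (j : ι) :
    ∑ i, |(cvaPath M n T p s - 1) i j| ≤ (1 + ρ) ^ ((d + 2) * n) - 1 := by
  -- columns of `P·F − 1` through the transpose `Fᵀ·Pᵀ − 1`
  have hline : ∀ j, ∑ i, |(cvaLine M n T p s - 1) i j| ≤ (1 + ρ) ^ n - 1 := fun j =>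
    (cols_mprod_sub_one_le hρ (fun t _ j' => hT _ _ j') j).trans (T4AxialChain.pow_sub_one_mono hρ hs)
  have hρ₁ : 0 ≤ (1 + ρ) ^ n - 1 := by have := one_le_pow₀ (M₀ := ℝ) (a := 1 + ρ) (by linarith) (n := n); linarith
  have hstair := cols_cvaStair_sub_one_le M n hρ hT (blockCoords n M p.1).1 (blockCoords n M p.1).2 p.2
  rw [cvaPath, cols_eq_rows_transpose, Matrix.transpose_sub, Matrix.transpose_one, Matrix.transpose_mul]
  have h1 : ∀ j, ∑ i, |((cvaLine M n T p s)ᵀ - 1) j i| ≤ (1 + ρ) ^ n - 1 := fun j => by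
    simpa only [cols_eq_rows_transpose, Matrix.transpose_sub, Matrix.transpose_one] using hline j
  have h2 : ∀ j, ∑ i, |((cvaStair M n T (blockCoords n M p.1).1 (blockCoords n M p.1).2 p.2)ᵀ - 1) j i| ≤ (1 + ρ) ^ ((d + 1) * n) - 1 := fun j => by
    simpa only [cols_eq_rows_transpose, Matrix.transpose_sub, Matrix.transpose_one] using hstair j
  have hρ₂ : 0 ≤ (1 + ρ) ^ ((d + 1) * n) - 1 := by have := one_le_pow₀ (M₀ := ℝ) (a := 1 + ρ) (by linarith) (n := (d + 1) * n); linarith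
  refine (rows_mul_sub_one_le hρ₂ h1 h2 j).trans (le_of_eq ?_)
  rw [add_sub_cancel, add_sub_cancel, ← pow_add]; ring_nf

/-- Rows of the transport itself: `≤ (1+ρ)^{(d+2)n}`. [folklore] -/
theorem rows_cvaPath_le {T : Fin (d + 1) → Tor (fine n M) × Fin (d + 1) → Matrix ι ι ℝ} {ρ : ℝ} (hρ : 0 ≤ ρ)
    (hT : ∀ μ p i, ∑ j, |(T μ p - 1) i j| ≤ ρ) (p : Tor (fine n M) × Fin (d + 1)) {s : ℕ} (hs : s ≤ n) (i : ι) :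
    ∑ j, |cvaPath M n T p s i j| ≤ (1 + ρ) ^ ((d + 2) * n) := by
  have h := rows_le_of_rows_sub_one (fun i => rows_cvaPath_sub_one_le M n hρ hT p hs i) i
  linarith

/-- Columns of the transport itself: `≤ (1+ρ)^{(d+2)n}`. [folklore] -/
theorem cols_cvaPath_le {T : Fin (d + 1) → Tor (fine n M) × Fin (d + 1) → Matrix ι ι ℝ} {ρ : ℝ} (hρ : 0 ≤ ρ)
    (hT : ∀ μ p j, ∑ i, |(T μ p - 1) i j| ≤ ρ) (p : Tor (fine n M) × Fin (d + 1)) {s : ℕ} (hs : s ≤ n) (j : ι) :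
    ∑ i, |cvaPath M n T p s i j| ≤ (1 + ρ) ^ ((d + 2) * n) := by
  have h := cols_le_of_cols_sub_one (fun j => cols_cvaPath_sub_one_le M n hρ hT p hs j) j
  linarith

end Path

end Summit.QuantumFields.YangMills.BalabanUVNodes.N15.CovAvg

end
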